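import Literature.NumberTheory.QuadraticFields.KroneckerSplitting
import Literature.NumberTheory.QuadraticFields.FundamentalDiscriminant
import Mathlib.NumberTheory.NumberField.Discriminant.Different
import Mathlib.NumberTheory.NumberField.InfinitePlace.TotallyRealComplex
import Mathlib.NumberTheory.LSeries.PrimesInAP
import Mathlib.NumberTheory.LegendreSymbol.QuadraticReciprocity
import HarnessLib

/-!
# Imaginary quadratic fields with prescribed split primes (Dirichlet + quadratic reciprocity)

Topic `NumberTheory/QuadraticFields`, namespace `Literature.NumberTheory.QuadraticFields.Quadratic`
(continuing `HeegnerCondition.lean`, `KroneckerSplitting.lean`, `FundamentalDiscriminant.lean`).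
Everything here is PROVED (theorems only, no named facts).

The automorphy-lifting and potential-automorphy arguments over CM fields repeatedly need
auxiliary **imaginary quadratic fields in which a prescribed finite set of rational primes
splits** (and a given prime `p` is unramified): Clozel–Harris–Taylor 2008, §4; Barnet-Lamb–Gee–
Geraghty–Taylor 2014, §4; and — the occurrence formalised here — Allen–Calegari–Caraiani–Gee–
Helm–Le Hung–Newton–Scholze–Taylor–Thorne, *Potential automorphy over CM fields*, Ann. of Math.
197 (2023), proof of Thm. 6.1.1 (§6.5.12, p. 1074 of the journal = p. 89 of arXiv:1812.09999v3):

> We can find imaginary quadratic fields `E_a, E_b, E_c` satisfying the following conditions: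
> each rational prime lying below a place of `V₀ ∪ V₁ ∪ V₂` splits in `E_a · E_b · E_c`; the
> prime `p` is unramified in `E_a · E_b · E_c`; the primes `2, p` split in `E_a`; if
> `l ∉ {2, p}` is a rational prime [of a given finite list] or which is ramified in
> `E_0 · E_a · E_c`, then `l` splits in `E_b`; if `l ∉ {2, p}` is a rational prime which is
> ramified in `E_b`, then `l` splits in `E_c`.  For example, we can choose any `E_a` satisfying
> the given condition. Then we can choose `E_b = ℚ(√-p_b)`, where `p_b` is a prime satisfying
> `p_b ≡ 1 mod 4` and `p_b ≡ -1 mod l` for any prime `l` [of the list], and `E_c = ℚ(√-p_c)`,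
> where `p_c ≡ 1 mod 4p_b` is any prime not equal to `p`. (Use quadratic reciprocity to show
> that `p_c` splits in `E_b`.)

In the currency of this directory ("`l` splits in `K`" is
`((Ideal.span {(l : ℤ)}).primesOver (𝓞 K)).ncard = 2`, as in `KroneckerSplitting.lean` and the
tree's Heegner hypothesis) we prove:

* `isTotallyComplex_of_discr_neg` — a quadratic field with `d_K < 0` has no real place
  (`sign d_K = (-1)^{r₂}`); re-derived here from Mathlib to keep the import closure inside
  `QuadraticFields` (the same statement with the `EllipticCurves` closure is
  `Literature.NumberTheory.EllipticCurves.isImaginaryQuadratic_iff_discr_neg`).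
* `ncard_primesOver_eq_two_of_discr_eq_neg`, `ncard_primesOver_two_eq_two_of_discr_eq_neg`,
  `isUnramifiedIn_of_discr_eq_neg_prime` — for `d_K = -q`: an odd prime `l` with
  `q ≡ -1 (mod l)` splits, `2` splits when `q ≡ 7 (mod 8)`, and every prime `l ≠ q` is
  unramified (Mathlib's Dedekind discriminant theorem `NumberField.not_dvd_discr_iff_isUnramifiedIn`).
* `ncard_primesOver_eq_two_of_discr_eq_neg_four_mul` and the two quadratic-reciprocity lemmas
  `ncard_primesOver_eq_two_of_discr_eq_neg_four_mul_of_one_mod` (the prime `p_c ≡ 1 (mod 4p_b)`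
  splits in `ℚ(√-p_b)`) and `ncard_primesOver_eq_two_of_discr_eq_neg_four_mul_of_mod_eq_one`
  (`p_b ≡ 1 (mod 4)` splits in `ℚ(√-p_c)` when `p_c ≡ 1 (mod p_b)`) — for `d_K = -4p_b`.
* `exists_imaginaryQuadratic_forall_split` — **`E_a`**: for every finite set `T ⊂ ℕ` and bound
  `n` there are a prime `q > n`, `q ∉ T`, `q ≡ 7 (mod 8)`, and an imaginary quadratic field `K`
  with `d_K = -q` in which every prime of `T` splits and every prime `≠ q` is unramified
  (Dirichlet's theorem, Mathlib `Nat.forall_exists_prime_gt_and_zmodEq`, for `q ≡ -1 (mod 8∏T)`;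
  existence of the field from `exists_numberField_discr_eq`, `FundamentalDiscriminant.lean`).
* `exists_imaginaryQuadratic_pair` — **`E_b`, `E_c`** exactly as printed: primes
  `n < p_b < p_c`, `p_b ≡ 1 (mod 4)`, `p_b ≡ -1 (mod l)` for the odd primes `l ∈ T`,
  `p_c ≡ 1 (mod 4p_b)`, imaginary quadratic `E_b`, `E_c` with `d = -4p_b`, `-4p_c`, every odd
  prime of `T` split in `E_b`, `p_c` split in `E_b`, `p_b` split in `E_c`, and every prime
  `l ∉ {2, p_b}` (resp. `{2, p_c}`) unramified in `E_b` (resp. `E_c`).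

These are the number-field inputs of the step "`E = E_0 · E_a · E_b · E_c`" of the printed proof
of ACC+ Thm. 6.1.1 (tree: the named fact
`Literature.NumberTheory.Automorphic.ACCGHLNSTT2023.automorphyLifting_crystalline_weightZero`,
file `Automorphic/ACCAutomorphyLiftingCrystalline.lean`); the soluble CM extension `E_0` and the
`R = T` theorem (Cor. 6.5.5) are not in the tree.

## References

* [ACCGHLNSTT2023] P. B. Allen et al., *Potential automorphy over CM fields*, Ann. of Math. (2)
  197 (2023), 897–1113, §6.5.12 (proof of Thm. 6.1.1), the paragraph "We can find imaginary
  quadratic fields `E_a, E_b, E_c` …" (arXiv:1812.09999, p. 89).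
* [Marcus2018] D. A. Marcus, *Number Fields*, 2nd ed. (2018), Ch. 3, Thm. 25 (decomposition law
  in quadratic fields), Ch. 3, Thm. 24 / Ch. 4 (ramified primes divide the discriminant).
* [IrelandRosen1990] K. Ireland, M. Rosen, *A Classical Introduction to Modern Number Theory*,
  2nd ed., Ch. 5 (quadratic reciprocity), Ch. 16 §1 (Dirichlet's theorem), §13.1.
-/

noncomputable section

open scoped Classical

open Module NumberField NumberField.InfinitePlace Ideal

namespace Literature.NumberTheory.QuadraticFields.Quadratic

/-! ### Quadratic fields of negative discriminant are imaginary -/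

section Sign

variable {K : Type*} [Field K] [NumberField K]

/-- **A quadratic field with negative discriminant is totally complex** (Cox, *Primes of the
form `x² + ny²`*, p. 119: "imaginary (`d_K < 0`)"): `sign d_K = (-1)^{r₂}`
(Mathlib `NumberField.sign_discr`) and `r₁ + 2 r₂ = 2` force `r₂ = 1`, `r₁ = 0`. [folklore] -/
theorem isTotallyComplex_of_discr_neg (h2 : finrank ℚ K = 2) (hd : NumberField.discr K < 0) :
    IsTotallyComplex K := by
  rw [← nrRealPlaces_eq_zero_iff]
  have hsign := NumberField.sign_discr K
  rw [Int.sign_eq_neg_one_of_neg hd] at hsign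
  have hodd : Odd (nrComplexPlaces K) := by
    by_contra h
    rw [Nat.not_odd_iff_even] at h
    rw [h.neg_one_pow] at hsign
    norm_num at hsign
  have hrk := card_add_two_mul_card_eq_rank K
  rw [h2] at hrk
  obtain ⟨m, hm⟩ := hodd
  change nrRealPlaces K + 2 * nrComplexPlaces K = 2 at hrk
  omega

end Sign

/-! ### Splitting and ramification in a field of discriminant `-q` or `-4q` -/

section Discr

variable {K : Type*} [Field K] [NumberField K]

/-- The Legendre symbol of an integer congruent to `1` is `1`. [folklore] -/
theorem legendreSym_eq_one_of_cast_eq_one {l : ℕ} [Fact l.Prime] {a : ℤ}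
    (ha : (a : ZMod l) = 1) : legendreSym l a = 1 := by
  rw [legendreSym, ha, MulChar.map_one]

/-- **Odd primes `l` with `q ≡ -1 (mod l)` split in the quadratic field of discriminant `-q`**
(decomposition law, Marcus Ch. 3 Thm. 25: `(d_K / l) = (-q / l) = (1 / l) = 1`). This is why
ACC+ choose "`p_b ≡ -1 mod l`" (loc. cit.). [folklore] -/
theorem ncard_primesOver_eq_two_of_discr_eq_neg (h2 : finrank ℚ K = 2) {q : ℕ}
    (hq : NumberField.discr K = -q) {l : ℕ} (hl : l.Prime) (hl2 : l ≠ 2)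
    (hmod : (q : ZMod l) = -1) :
    ((span {(l : ℤ)}).primesOver (𝓞 K)).ncard = 2 := by
  haveI := Fact.mk hl
  rw [ncard_primesOver_eq_two_iff_legendreSym h2 hl2, hq]
  refine legendreSym_eq_one_of_cast_eq_one ?_
  rw [Int.cast_neg, Int.cast_natCast, hmod, neg_neg]

/-- **`2` splits in the quadratic field of discriminant `-q` when `q ≡ 7 (mod 8)`**
(`d_K = -q ≡ 1 (mod 8)`, Marcus Ch. 3 Thm. 25). [folklore] -/
theorem ncard_primesOver_two_eq_two_of_discr_eq_neg (h2 : finrank ℚ K = 2) {q : ℕ}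
    (hq : NumberField.discr K = -q) (hq8 : q % 8 = 7) :
    ((span {(2 : ℤ)}).primesOver (𝓞 K)).ncard = 2 := by
  rw [ncard_primesOver_two_eq_two_iff h2, hq]
  omega

/-- **In the quadratic field of discriminant `-q`, `q` prime, every prime `l ≠ q` is
unramified** (Dedekind: the ramified primes are the prime divisors of `d_K`; Mathlib
`NumberField.not_dvd_discr_iff_isUnramifiedIn`). In particular "the prime `p` is unramified in
`E_a`" (ACC+, loc. cit.) as soon as `p ≠ q`. [folklore] -/
theorem isUnramifiedIn_of_discr_eq_neg_prime {q : ℕ} (hqp : q.Prime)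
    (hq : NumberField.discr K = -q) {l : ℕ} (hl : l.Prime) (hlq : l ≠ q) :
    Algebra.IsUnramifiedIn (𝓞 K) (span {(l : ℤ)}) := by
  rw [← NumberField.not_dvd_discr_iff_isUnramifiedIn K (𝓞 K) (Nat.prime_iff_prime_int.mp hl),
    hq, Int.dvd_neg, Int.natCast_dvd_natCast]
  exact fun h => hlq ((Nat.prime_dvd_prime_iff_eq hl hqp).mp h)

/-- **In the quadratic field of discriminant `-4q`, `q` prime, every prime `l ∉ {2, q}` is
unramified** (Dedekind's discriminant theorem). [folklore] -/
theorem isUnramifiedIn_of_discr_eq_neg_four_mul_prime {q : ℕ} (hqp : q.Prime)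
    (hq : NumberField.discr K = -(4 * q)) {l : ℕ} (hl : l.Prime) (hl2 : l ≠ 2) (hlq : l ≠ q) :
    Algebra.IsUnramifiedIn (𝓞 K) (span {(l : ℤ)}) := by
  rw [← NumberField.not_dvd_discr_iff_isUnramifiedIn K (𝓞 K) (Nat.prime_iff_prime_int.mp hl),
    hq, Int.dvd_neg]
  intro h
  have h' : l ∣ 4 * q := by exact_mod_cast h
  rcases (Nat.Prime.dvd_mul hl).mp h' with h4 | hq'
  · exact hl2 ((Nat.prime_dvd_prime_iff_eq hl Nat.prime_two).mp
      (hl.dvd_of_dvd_pow (show l ∣ 2 ^ 2 by simpa using h4)))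
  · exact hlq ((Nat.prime_dvd_prime_iff_eq hl hqp).mp hq')

/-- **Odd primes `l` with `q ≡ -1 (mod l)` split in the quadratic field of discriminant `-4q`**
(`-4q ≡ 2² (mod l)` is a non-zero square). [folklore] -/
theorem ncard_primesOver_eq_two_of_discr_eq_neg_four_mul (h2 : finrank ℚ K = 2) {q : ℕ}
    (hq : NumberField.discr K = -(4 * q)) {l : ℕ} (hl : l.Prime) (hl2 : l ≠ 2)
    (hmod : (q : ZMod l) = -1) :
    ((span {(l : ℤ)}).primesOver (𝓞 K)).ncard = 2 := by
  haveI := Fact.mk hl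
  rw [ncard_primesOver_eq_two_iff_legendreSym h2 hl2, hq]
  have hcast : ((-(4 * q : ℤ) : ℤ) : ZMod l) = 2 ^ 2 := by
    push_cast
    rw [hmod]
    ring
  have h0 : ((-(4 * q : ℤ) : ℤ) : ZMod l) ≠ 0 := by
    rw [hcast]
    exact pow_ne_zero 2 (two_ne_zero_zmod hl2)
  exact (legendreSym.eq_one_iff l h0).mpr ⟨2, by rw [hcast, sq]⟩

/-- **Quadratic reciprocity step of ACC+ (loc. cit.): `p_c` splits in `E_b = ℚ(√-p_b)`.** If
`p_b, p_c` are odd primes, `p_c ≡ 1 (mod 4)` and `p_c ≡ 1 (mod p_b)`, then `p_c` splits in the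
quadratic field of discriminant `-4p_b`: `(-4p_b / p_c) = (-1/p_c)(4/p_c)(p_b/p_c)` with
`(-1/p_c) = 1` (`p_c ≡ 1 (mod 4)`), `(4/p_c) = 1`, and `(p_b/p_c) = (p_c/p_b) = (1/p_b) = 1` by
quadratic reciprocity (Mathlib `legendreSym.quadratic_reciprocity_one_mod_four`).
[cite: ACCGHLNSTT2023, §6.5.12, "Use quadratic reciprocity to show that p_c splits in E_b"] -/
theorem ncard_primesOver_eq_two_of_discr_eq_neg_four_mul_of_one_mod (h2 : finrank ℚ K = 2)
    {pb pc : ℕ} (hpb : pb.Prime) (hpb2 : pb ≠ 2) (hpc : pc.Prime) (hpc4 : pc % 4 = 1)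
    (hq : NumberField.discr K = -(4 * pb)) (hmod : (pc : ZMod pb) = 1) :
    ((span {(pc : ℤ)}).primesOver (𝓞 K)).ncard = 2 := by
  haveI := Fact.mk hpc
  haveI := Fact.mk hpb
  have hpc2 : pc ≠ 2 := by
    rintro rfl
    norm_num at hpc4
  rw [ncard_primesOver_eq_two_iff_legendreSym h2 hpc2, hq]
  have hsplit : (-(4 * pb : ℤ) : ℤ) = -1 * 2 ^ 2 * pb := by ring
  have h2ne : ((2 : ℤ) : ZMod pc) ≠ 0 := by exact_mod_cast two_ne_zero_zmod hpc2
  rw [hsplit, legendreSym.mul, legendreSym.mul, legendreSym.at_neg_one hpc2,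
    ZMod.χ₄_nat_one_mod_four hpc4, legendreSym.sq_one' pc h2ne,
    ← legendreSym.quadratic_reciprocity_one_mod_four hpc4 hpb2, one_mul, one_mul]
  exact legendreSym_eq_one_of_cast_eq_one (by rw [Int.cast_natCast, hmod])

/-- **`p_b` splits in `E_c = ℚ(√-p_c)`** (ACC+, loc. cit.): if `p_b ≡ 1 (mod 4)` is prime and
`p_c ≡ 1 (mod p_b)`, then `p_b` splits in the quadratic field of discriminant `-4p_c`, since
`-4p_c ≡ -4 = (2i)² (mod p_b)` with `i² = -1` (`p_b ≡ 1 (mod 4)`, Mathlib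
`ZMod.exists_sq_eq_neg_one_iff`). [cite: ACCGHLNSTT2023, §6.5.12] -/
theorem ncard_primesOver_eq_two_of_discr_eq_neg_four_mul_of_mod_eq_one (h2 : finrank ℚ K = 2)
    {pb pc : ℕ} (hpb : pb.Prime) (hpb4 : pb % 4 = 1)
    (hq : NumberField.discr K = -(4 * pc)) (hmod : (pc : ZMod pb) = 1) :
    ((span {(pb : ℤ)}).primesOver (𝓞 K)).ncard = 2 := by
  haveI := Fact.mk hpb
  have hpb2 : pb ≠ 2 := by
    rintro rfl
    norm_num at hpb4
  rw [ncard_primesOver_eq_two_iff_legendreSym h2 hpb2, hq]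
  obtain ⟨i, hi⟩ := ZMod.exists_sq_eq_neg_one_iff.mpr (by rw [hpb4]; decide : pb % 4 ≠ 3)
  have hcast : ((-(4 * pc : ℤ) : ℤ) : ZMod pb) = (2 * i) ^ 2 := by
    push_cast
    rw [hmod, mul_pow, sq i, ← hi]
    ring
  have h0 : ((-(4 * pc : ℤ) : ℤ) : ZMod pb) ≠ 0 := by
    rw [hcast]
    refine pow_ne_zero 2 (mul_ne_zero (two_ne_zero_zmod hpb2) ?_)
    rintro rfl
    rw [mul_zero] at hi
    exact one_ne_zero (neg_eq_zero.mp hi)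
  exact (legendreSym.eq_one_iff pb h0).mpr ⟨2 * i, by rw [hcast, sq]⟩

end Discr

/-! ### Dirichlet: primes in the residue classes used by ACC+ -/

section Dirichlet

/-- Reduction of a congruence modulo `N` to a divisor `l ∣ N`, in `ZMod l`. [folklore] -/
theorem intCast_zmod_eq_of_modEq_of_dvd {N l : ℕ} {q a : ℤ} (h : q ≡ a [ZMOD N])
    (hl : l ∣ N) : (q : ZMod l) = (a : ZMod l) :=
  (ZMod.intCast_eq_intCast_iff _ _ _).mpr (h.of_dvd (Int.natCast_dvd_natCast.mpr hl))

/-- **Dirichlet's theorem, the class `-1`**: for `N ≠ 0` and any bound `n` there is a prime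
`q > n` with `q ≡ -1 (mod N)` (Mathlib `Nat.forall_exists_prime_gt_and_zmodEq`). [folklore] -/
theorem exists_prime_gt_modEq_neg_one {N : ℕ} (hN : N ≠ 0) (n : ℕ) :
    ∃ q : ℕ, q.Prime ∧ n < q ∧ (q : ℤ) ≡ -1 [ZMOD N] := by
  obtain ⟨q, hqn, hq, hmod⟩ :=
    Nat.forall_exists_prime_gt_and_zmodEq n (q := N) (a := -1) hN isCoprime_one_left.neg_left
  exact ⟨q, hq, hqn, hmod⟩

/-- **Dirichlet's theorem, the class of ACC+'s `p_b`**: for `M` odd, `M ≠ 0`… more precisely for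
every `M ≥ 1` odd and bound `n` there is a prime `q > n` with `q ≡ 2M - 1 (mod 4M)`, i.e.
`q ≡ 1 (mod 4)` and `q ≡ -1 (mod l)` for every `l ∣ M` ((`2M - 1`) is prime to `4M`:
`-(2M + 1)(2M - 1) + M · 4M = 1`). [folklore] -/
theorem exists_prime_gt_modEq_two_mul_sub_one {M : ℕ} (hM : M ≠ 0) (n : ℕ) :
    ∃ q : ℕ, q.Prime ∧ n < q ∧ (q : ℤ) ≡ 2 * M - 1 [ZMOD (4 * M : ℕ)] := by
  have hcop : IsCoprime (2 * M - 1 : ℤ) ((4 * M : ℕ) : ℤ) :=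
    ⟨-(2 * M + 1), M, by push_cast; ring⟩
  obtain ⟨q, hqn, hq, hmod⟩ :=
    Nat.forall_exists_prime_gt_and_zmodEq n (q := 4 * M) (a := 2 * M - 1)
      (mul_ne_zero four_ne_zero hM) hcop
  exact ⟨q, hq, hqn, hmod⟩

end Dirichlet

/-! ### `E_a`: one imaginary quadratic field in which a given finite set of primes splits -/

section Ea

/-- **Existence of `q` and `K = ℚ(√-q)`.** For every finite `T ⊂ ℕ` and bound `n` there are a
prime `q > n` with `q ≡ -1 (mod 8 · ∏_{l ∈ T, l ≠ 0} l)` — so `q ≡ 7 (mod 8)` and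
`q ≡ -1 (mod l)` for `0 ≠ l ∈ T` — and a quadratic number field `K` with `d_K = -q`
(`-q ≡ 1 (mod 4)` is a fundamental discriminant; `exists_numberField_discr_eq`). [folklore] -/
theorem exists_prime_and_field_discr_eq_neg (T : Finset ℕ) (n : ℕ) :
    ∃ (q : ℕ) (K : Type) (_ : Field K) (_ : NumberField K),
      q.Prime ∧ n < q ∧ q % 8 = 7 ∧ (∀ l ∈ T, l ≠ 0 → (q : ZMod l) = -1) ∧
        finrank ℚ K = 2 ∧ NumberField.discr K = -q := by
  set N : ℕ := 8 * ∏ l ∈ T.erase 0, l with hN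
  have hN0 : N ≠ 0 := mul_ne_zero (by norm_num)
    (Finset.prod_ne_zero_iff.mpr fun l hl => (Finset.mem_erase.mp hl).1)
  obtain ⟨q, hq, hqn, hmod⟩ := exists_prime_gt_modEq_neg_one hN0 n
  -- `q ≡ 7 (mod 8)`
  have h8 : (q : ℤ) ≡ -1 [ZMOD (8 : ℕ)] := hmod.of_dvd (by rw [hN]; exact_mod_cast dvd_mul_right 8 _)
  have hq8 : q % 8 = 7 := by
    have h8' := h8
    rw [Int.ModEq] at h8'
    omega
  -- `q ≡ -1 (mod l)` for `0 ≠ l ∈ T`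
  have hl : ∀ l ∈ T, l ≠ 0 → (q : ZMod l) = -1 := by
    intro l hlT hl0
    have hdvd : l ∣ N := by
      rw [hN]
      exact (Finset.dvd_prod_of_mem _ (Finset.mem_erase.mpr ⟨hl0, hlT⟩)).mul_left 8
    have := intCast_zmod_eq_of_modEq_of_dvd hmod hdvd
    rwa [Int.cast_natCast, Int.cast_neg, Int.cast_one] at this
  -- the field
  have hD : ((-(q : ℤ)) % 4 = 1 ∧ Squarefree (-(q : ℤ)) ∧ -(q : ℤ) ≠ 1) ∨
      (4 ∣ -(q : ℤ) ∧ (-(q : ℤ) / 4 % 4 = 2 ∨ -(q : ℤ) / 4 % 4 = 3) ∧ Squarefree (-(q : ℤ) / 4)) := by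
    refine Or.inl ⟨by omega, ?_, by omega⟩
    rw [← Int.squarefree_natAbs]
    simpa using hq.squarefree
  obtain ⟨K, _, _, h2, hdisc⟩ := exists_numberField_discr_eq hD
  exact ⟨q, K, inferInstance, inferInstance, hq, hqn, hq8, hl, h2, hdisc⟩

/-- **`E_a`: an imaginary quadratic field in which a prescribed finite set of primes splits**
(ACC+ Thm. 6.1.1, proof, §6.5.12: "Each rational prime lying below a place of `V₀ ∪ V₁ ∪ V₂`
splits in `E_a · E_b · E_c`. The prime `p` is unramified in `E_a · E_b · E_c`. The primes `2, p`
split in `E_a`"; likewise CHT 2008 §4, BLGGT 2014 §4). For every finite `T ⊂ ℕ` and bound `n`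
there are a prime `q > n`, `q ∉ T`, `q ≡ 7 (mod 8)`, and a number field `K` with `[K : ℚ] = 2`,
no real place, `d_K = -q`, in which **every prime `l ∈ T` splits** (two primes of `𝓞 K` above
`l`) and **every prime `l ≠ q` is unramified** (so a prime `p` is unramified in `K` as soon as
`p ∈ T` or `p ≤ n`). Proof: `q ≡ -1 (mod 8∏T)` by Dirichlet; `K = ℚ(√-q)`; the decomposition
law. [cite: ACCGHLNSTT2023, §6.5.12 (fields `E_a, E_b, E_c`)] -/
theorem exists_imaginaryQuadratic_forall_split (T : Finset ℕ) (n : ℕ) :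
    ∃ (K : Type) (_ : Field K) (_ : NumberField K) (q : ℕ),
      finrank ℚ K = 2 ∧ IsTotallyComplex K ∧ q.Prime ∧ n < q ∧ q ∉ T ∧ q % 8 = 7 ∧
        NumberField.discr K = -q ∧
        (∀ l ∈ T, l.Prime → ((span {(l : ℤ)}).primesOver (𝓞 K)).ncard = 2) ∧
        ∀ l : ℕ, l.Prime → l ≠ q → Algebra.IsUnramifiedIn (𝓞 K) (span {(l : ℤ)}) := by
  obtain ⟨q, K, _, _, hq, hqn, hq8, hmod, h2, hdisc⟩ :=
    exists_prime_and_field_discr_eq_neg T (max n (T.sup id))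
  have hqT : q ∉ T := fun h => by
    have : q ≤ T.sup id := Finset.le_sup (f := id) h
    omega
  refine ⟨K, inferInstance, inferInstance, q, h2, ?_, hq, lt_of_le_of_lt (le_max_left _ _) hqn,
    hqT, hq8, hdisc, fun l hlT hl => ?_, fun l hl hlq => isUnramifiedIn_of_discr_eq_neg_prime hq hdisc hl hlq⟩
  · exact isTotallyComplex_of_discr_neg h2 (by rw [hdisc, neg_lt_zero]; exact_mod_cast hq.pos)
  · by_cases hl2 : l = 2
    · subst hl2
      exact_mod_cast ncard_primesOver_two_eq_two_of_discr_eq_neg h2 hdisc hq8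
    · exact ncard_primesOver_eq_two_of_discr_eq_neg h2 hdisc hl hl2 (hmod l hlT hl.ne_zero)

end Ea

/-! ### `E_b`, `E_c`: the quadratic-reciprocity pair -/

section Pair

/-- **Existence of `p_b` and `E_b = ℚ(√-p_b)`.** For every finite `T ⊂ ℕ` and bound `n` there
are a prime `p_b > n` with `p_b ≡ 1 (mod 4)` and `p_b ≡ -1 (mod l)` for every ODD `l ∈ T`, and a
quadratic number field `E_b` with `d = -4p_b` (`-p_b ≡ 3 (mod 4)` squarefree, so `-4p_b` is a
fundamental discriminant). [cite: ACCGHLNSTT2023, §6.5.12 ("`p_b ≡ 1 mod 4` and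
`p_b ≡ -1 mod l`")] -/
theorem exists_prime_and_field_discr_eq_neg_four_mul (T : Finset ℕ) (n : ℕ) :
    ∃ (pb : ℕ) (K : Type) (_ : Field K) (_ : NumberField K),
      pb.Prime ∧ n < pb ∧ pb % 4 = 1 ∧ (∀ l ∈ T, ¬ 2 ∣ l → (pb : ZMod l) = -1) ∧
        finrank ℚ K = 2 ∧ NumberField.discr K = -(4 * pb) := by
  set M : ℕ := ∏ l ∈ T.filter (fun l => ¬ 2 ∣ l), l with hM
  have hModd : ¬ 2 ∣ M := by
    rw [hM]
    exact Prime.not_dvd_finsetProd Nat.prime_two.prime fun l hl => (Finset.mem_filter.mp hl).2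
  have hM0 : M ≠ 0 := fun h => hModd (h ▸ dvd_zero 2)
  obtain ⟨pb, hpb, hpbn, hmod⟩ := exists_prime_gt_modEq_two_mul_sub_one hM0 n
  -- `p_b ≡ 1 (mod 4)`
  have h4 : (pb : ℤ) ≡ 2 * M - 1 [ZMOD (4 : ℕ)] :=
    hmod.of_dvd (by exact_mod_cast dvd_mul_right 4 M)
  have hpb4 : pb % 4 = 1 := by
    have h4' := h4
    rw [Int.ModEq] at h4'
    have hModd' : M % 2 = 1 := Nat.two_dvd_ne_zero.mp hModd
    omega
  -- `p_b ≡ -1 (mod l)` for odd `l ∈ T`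
  have hl : ∀ l ∈ T, ¬ 2 ∣ l → (pb : ZMod l) = -1 := by
    intro l hlT hl2
    have hdvd : l ∣ M := by
      rw [hM]
      exact Finset.dvd_prod_of_mem _ (Finset.mem_filter.mpr ⟨hlT, hl2⟩)
    have h := intCast_zmod_eq_of_modEq_of_dvd hmod (hdvd.mul_left 4)
    have hM0' : (M : ZMod l) = 0 := (ZMod.natCast_eq_zero_iff M l).mpr hdvd
    rw [Int.cast_natCast] at h
    rw [h]
    push_cast
    rw [hM0', mul_zero, zero_sub]
  -- the field
  have hD : ((-(4 * pb : ℤ)) % 4 = 1 ∧ Squarefree (-(4 * pb : ℤ)) ∧ -(4 * pb : ℤ) ≠ 1) ∨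
      (4 ∣ -(4 * pb : ℤ) ∧ (-(4 * pb : ℤ) / 4 % 4 = 2 ∨ -(4 * pb : ℤ) / 4 % 4 = 3) ∧
        Squarefree (-(4 * pb : ℤ) / 4)) := by
    refine Or.inr ⟨⟨-pb, by ring⟩, ?_, ?_⟩
    · omega
    · have : -(4 * pb : ℤ) / 4 = -pb := by omega
      rw [this, ← Int.squarefree_natAbs]
      simpa using hpb.squarefree
  obtain ⟨K, _, _, h2, hdisc⟩ := exists_numberField_discr_eq hD
  exact ⟨pb, K, inferInstance, inferInstance, hpb, hpbn, hpb4, hl, h2, hdisc⟩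

/-- **Existence of `p_c` and `E_c = ℚ(√-p_c)`.** For every prime `p_b` and bound `n` there
are a prime `p_c > n` with `p_c ≡ 1 (mod 4p_b)` and a quadratic number field `E_c` with
`d = -4p_c`. [cite: ACCGHLNSTT2023, §6.5.12 ("`p_c ≡ 1 mod 4p_b` is any prime not equal to
`p`")] -/
theorem exists_prime_and_field_discr_eq_neg_four_mul_of_prime {pb : ℕ} (hpb : pb.Prime) (n : ℕ) :
    ∃ (pc : ℕ) (K : Type) (_ : Field K) (_ : NumberField K),
      pc.Prime ∧ n < pc ∧ pc % 4 = 1 ∧ (pc : ZMod pb) = 1 ∧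
        finrank ℚ K = 2 ∧ NumberField.discr K = -(4 * pc) := by
  obtain ⟨pc, hpcn, hpc, hmod⟩ :=
    Nat.forall_exists_prime_gt_and_modEq n (q := 4 * pb) (a := 1)
      (mul_ne_zero four_ne_zero hpb.ne_zero) (Nat.coprime_one_left _)
  have hpc4 : pc % 4 = 1 := by
    have h := (hmod.of_dvd (dvd_mul_right 4 pb))
    rw [Nat.ModEq] at h
    omega
  have hmod' : (pc : ZMod pb) = 1 := by
    have h := (ZMod.natCast_eq_natCast_iff _ _ _).mpr (hmod.of_dvd (dvd_mul_left pb 4))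
    rwa [Nat.cast_one] at h
  have hD : ((-(4 * pc : ℤ)) % 4 = 1 ∧ Squarefree (-(4 * pc : ℤ)) ∧ -(4 * pc : ℤ) ≠ 1) ∨
      (4 ∣ -(4 * pc : ℤ) ∧ (-(4 * pc : ℤ) / 4 % 4 = 2 ∨ -(4 * pc : ℤ) / 4 % 4 = 3) ∧
        Squarefree (-(4 * pc : ℤ) / 4)) := by
    refine Or.inr ⟨⟨-pc, by ring⟩, ?_, ?_⟩
    · omega
    · have : -(4 * pc : ℤ) / 4 = -pc := by omega
      rw [this, ← Int.squarefree_natAbs]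
      simpa using hpc.squarefree
  obtain ⟨K, _, _, h2, hdisc⟩ := exists_numberField_discr_eq hD
  exact ⟨pc, K, inferInstance, inferInstance, hpc, hpcn, hpc4, hmod', h2, hdisc⟩

/-- **`E_b` and `E_c` (ACC+ Thm. 6.1.1, proof, §6.5.12), as printed.** For every finite `T ⊂ ℕ`
(the odd primes `l ∉ {2, p}` "lying below a place of `E_0` at which `π_{E_0}` or `ρ` is ramified,
or ramified in `E_0 · E_a`") and every bound `n` (to be taken `≥ p`), there are primes
`n < p_b < p_c` with `p_b ≡ 1 (mod 4)`, `p_b ≡ -1 (mod l)` for the odd `l ∈ T`,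
`p_c ≡ 1 (mod 4p_b)`, and imaginary quadratic fields `E_b = ℚ(√-p_b)` (`d = -4p_b`) and
`E_c = ℚ(√-p_c)` (`d = -4p_c`) such that: every odd prime `l ∈ T` splits in `E_b`; `p_c` — the
only odd prime ramified in `E_c` — splits in `E_b` ("use quadratic reciprocity"); `p_b` — the only
odd prime ramified in `E_b` — splits in `E_c`; and every prime `l ∉ {2, p_b}` (resp.
`l ∉ {2, p_c}`) is unramified in `E_b` (resp. `E_c`), in particular `p` is, once `p ≤ n`.
(The prime `2`, ramified in both, is taken care of by `E_a`, in which `2` splits: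
`exists_imaginaryQuadratic_forall_split`.) [cite: ACCGHLNSTT2023, §6.5.12 (fields `E_b, E_c`)] -/
theorem exists_imaginaryQuadratic_pair (T : Finset ℕ) (n : ℕ) :
    ∃ (Eb : Type) (_ : Field Eb) (_ : NumberField Eb) (Ec : Type) (_ : Field Ec) (_ : NumberField Ec)
      (pb pc : ℕ),
      finrank ℚ Eb = 2 ∧ IsTotallyComplex Eb ∧ finrank ℚ Ec = 2 ∧ IsTotallyComplex Ec ∧
      pb.Prime ∧ pc.Prime ∧ n < pb ∧ pb < pc ∧ pb % 4 = 1 ∧ pc % 4 = 1 ∧ (pc : ZMod pb) = 1 ∧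
      NumberField.discr Eb = -(4 * pb) ∧ NumberField.discr Ec = -(4 * pc) ∧
      (∀ l ∈ T, l.Prime → l ≠ 2 → ((span {(l : ℤ)}).primesOver (𝓞 Eb)).ncard = 2) ∧
      ((span {(pc : ℤ)}).primesOver (𝓞 Eb)).ncard = 2 ∧
      ((span {(pb : ℤ)}).primesOver (𝓞 Ec)).ncard = 2 ∧
      (∀ l : ℕ, l.Prime → l ≠ 2 → l ≠ pb → Algebra.IsUnramifiedIn (𝓞 Eb) (span {(l : ℤ)})) ∧
      ∀ l : ℕ, l.Prime → l ≠ 2 → l ≠ pc → Algebra.IsUnramifiedIn (𝓞 Ec) (span {(l : ℤ)}) := by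
  obtain ⟨pb, Eb, _, _, hpb, hpbn, hpb4, hmodb, h2b, hdiscb⟩ :=
    exists_prime_and_field_discr_eq_neg_four_mul T n
  have hpb2 : pb ≠ 2 := by
    rintro rfl
    norm_num at hpb4
  obtain ⟨pc, Ec, _, _, hpc, hpcn, hpc4, hmodc, h2c, hdiscc⟩ :=
    exists_prime_and_field_discr_eq_neg_four_mul_of_prime hpb pb
  have hpc2 : pc ≠ 2 := by
    rintro rfl
    norm_num at hpc4
  have hpbc : pb ≠ pc := (Nat.ne_of_lt hpcn)
  refine ⟨Eb, inferInstance, inferInstance, Ec, inferInstance, inferInstance, pb, pc, h2b, ?_, h2c,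
    ?_, hpb, hpc, hpbn, hpcn, hpb4, hpc4, hmodc, hdiscb, hdiscc, fun l hlT hl hl2 => ?_, ?_, ?_,
    fun l hl hl2 hlpb => isUnramifiedIn_of_discr_eq_neg_four_mul_prime hpb hdiscb hl hl2 hlpb,
    fun l hl hl2 hlpc => isUnramifiedIn_of_discr_eq_neg_four_mul_prime hpc hdiscc hl hl2 hlpc⟩
  · exact isTotallyComplex_of_discr_neg h2b
      (by rw [hdiscb, neg_lt_zero]; exact_mod_cast mul_pos four_pos hpb.pos)
  · exact isTotallyComplex_of_discr_neg h2c
      (by rw [hdiscc, neg_lt_zero]; exact_mod_cast mul_pos four_pos hpc.pos)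
  · exact ncard_primesOver_eq_two_of_discr_eq_neg_four_mul h2b hdiscb hl hl2
      (hmodb l hlT fun h => hl2 ((Nat.prime_dvd_prime_iff_eq Nat.prime_two hl).mp h).symm)
  · exact ncard_primesOver_eq_two_of_discr_eq_neg_four_mul_of_one_mod h2b hpb hpb2 hpc hpc4 hdiscb
      hmodc
  · exact ncard_primesOver_eq_two_of_discr_eq_neg_four_mul_of_mod_eq_one h2c hpb hpb4 hdiscc hmodc

end Pair

end Literature.NumberTheory.QuadraticFields.Quadratic

end
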